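import Mathlib
import HarnessLib
import Summits.RiemannHypothesis.RiemannHypothesis.Theses.RuelleBand
import Summits.RiemannHypothesis.RiemannHypothesis.Theorems.RuelleBandAsymptoticToRealisation
import Literature.Analysis.UnboundedOperators.DiagonalOperatorCompact

/-!
# RiemannHypothesis / RuelleBand — the Lasota–Yorke realisation exists under `AsymptoticCriticalLine`

Route `RiemannHypothesis/RuelleBand`, crux item stmt-RiemannHypothesis-2063
(`AsymptoticCriticalLine`), line `interior-edge-split`, helper file (`--supports`). Everything is
proved; no definitions.

This is the HONESTY CONVERSE of the Lasota–Yorke / Hennion engine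
`asymptoticCriticalLine_of_lasotaYorkeRealisation`: the engine says that a complex Hilbert space
`H`, a seminorm `w` whose restriction to the unit ball is totally bounded, a semigroup `T (t ≥ 0)`
with an a-priori Lasota–Yorke inequality `‖(T t₀)ⁿ f‖ ≤ C_ε e^{n ε t₀} ‖f‖ + R_{n,ε} w(f)` for
every `ε > 0`, and one-sided joint eigenvectors `T t v = e^{t(ρ − 1/2)} v` at all zeros `ρ` of `ζ`
in the open critical strip, together imply `AsymptoticCriticalLine`. Here we prove that, conversely,
`AsymptoticCriticalLine` produces such data, so the `∃`-typed hypothesis of the engine is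
calibrated as *equivalent* to the crux (circular as an `∃`-statement, like `BandRealisation`).

**Proof (the diagonal model).** Index `H := ℓ²(ι, ℂ)` by the zero set
`ι := {s // ζ s = 0 ∧ 0 < Re s < 1}` itself, with standard Hilbert basis `b`, and let
`T t := diag (e^{t(ρ − 1/2)})_ρ` (`HilbertBasis.diagonalCLM`; a one-parameter group, every `b ρ`
a joint eigenvector, as in `RuelleBandAsymptoticToRealisation`). The weak seminorm is
`w f := ‖D f‖` with `D := diag (|Re ρ − 1/2|)_ρ`. Under `AsymptoticCriticalLine` the symbol
`|Re ρ − 1/2|` tends to `0` along the cofinite filter, so `D` is compact (Halmos, Problem 171: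
`HilbertBasis.isCompactOperator_diagonalCLM_of_tendsto_zero`), the image of the unit ball is
totally bounded, and pulling back a finite `η`-net gives the finite `w`-net. For the
Lasota–Yorke inequality with `t₀ = 1`, `C = 1`: `(T 1)ⁿ = T n = diag (e^{n(ρ − 1/2)})`; split the
symbol at level `ε`: on `{|Re ρ − 1/2| < ε}` it has modulus `< e^{n ε}`, and on
`{|Re ρ − 1/2| ≥ ε}` it equals `q_ρ · |Re ρ − 1/2|` with `|q_ρ| ≤ e^{n/2} / ε`, so
`T n = diag(p) + diag(q) ∘ D` with `‖diag p‖ ≤ e^{n ε}`, whence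
`‖(T 1)ⁿ f‖ ≤ e^{n ε} ‖f‖ + ‖diag q‖ · w(f)`.

References: P. R. Halmos, *A Hilbert Space Problem Book* (1982), Problems 61–63, 171;
H. Hennion, Proc. Amer. Math. Soc. 118 (1993) (the two-norm inequality); in tree
`Literature/Analysis/UnboundedOperators/DiagonalOperator{,Compact}.lean`,
`Summits/…/Theorems/RuelleBandAsymptoticToRealisation.lean`.
-/

noncomputable section

-- D-0017: `Summit.<S>.<S>.…` is the designed namespace of a single-problem summit.
set_option linter.dupNamespace false

namespace Summit.RiemannHypothesis.RiemannHypothesis.Theorems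

open Complex Filter Topology
open scoped lp
open Summit.RiemannHypothesis.RiemannHypothesis.Theses.RuelleBand

/-- A compact operator maps the unit ball to a totally bounded set; pulled back, this is a finite
net of the unit ball for the seminorm `f ↦ ‖D f‖`: for every `η > 0` there is a finite set `F`
such that every `f` with `‖f‖ ≤ 1` has `‖D (f - g)‖ < η` for some `g ∈ F`. [folklore] -/
theorem exists_finset_norm_map_sub_lt_of_isCompactOperator {E E' : Type*} [NormedAddCommGroup E]
    [NormedSpace ℂ E] [NormedAddCommGroup E'] [NormedSpace ℂ E'] (D : E →L[ℂ] E')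
    (hD : IsCompactOperator D) (η : ℝ) (hη : 0 < η) :
    ∃ F : Finset E, ∀ f : E, ‖f‖ ≤ 1 → ∃ g ∈ F, ‖D (f - g)‖ < η := by
  classical
  have htb : TotallyBounded (D '' Metric.closedBall (0 : E) 1) :=
    (hD.isCompact_closure_image_closedBall 1).totallyBounded.subset subset_closure
  obtain ⟨t, hts, htf, hcover⟩ := Metric.finite_approx_of_totallyBounded htb η hη
  have hpre : ∀ y ∈ t, ∃ g : E, D g = y := by
    intro y hy
    obtain ⟨g, -, rfl⟩ := hts hy
    exact ⟨g, rfl⟩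
  choose! s hsD using hpre
  refine ⟨htf.toFinset.image s, fun f hf => ?_⟩
  have hDf : D f ∈ D '' Metric.closedBall (0 : E) 1 := ⟨f, mem_closedBall_zero_iff.2 hf, rfl⟩
  obtain ⟨y, hy, hfy⟩ := Set.mem_iUnion₂.1 (hcover hDf)
  refine ⟨s y, Finset.mem_image_of_mem s (htf.mem_toFinset.2 hy), ?_⟩
  rw [map_sub, hsD y hy, ← dist_eq_norm]
  exact Metric.mem_ball.1 hfy

/-- **The diagonal Lasota–Yorke group.** For any family `ρ : ι → ℂ` in the open critical strip
whose real parts tend to `1/2` along the cofinite filter, the diagonal operators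
`T t := diag(e^{t(ρ i − 1/2)})` on `ℓ²(ι, ℂ)` and the weak seminorm `w f := ‖diag(|Re ρ i − 1/2|) f‖`
satisfy: `T` is a one-parameter group, the unit ball has finite `w`-nets, the Lasota–Yorke
inequality `‖(T 1)ⁿ f‖ ≤ e^{n ε} ‖f‖ + R_{n, ε} w(f)` holds for every `ε > 0`, and every `ρ i` is
a joint eigenvalue (eigenvector the `i`-th basis vector). [folklore] -/
theorem exists_diagonalLasotaYorkeGroup {ι : Type} (ρ : ι → ℂ)
    (hρ : ∀ i, 0 < (ρ i).re ∧ (ρ i).re < 1)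
    (hlim : ∀ ε : ℝ, 0 < ε → {i : ι | ε ≤ |(ρ i).re - 1 / 2|}.Finite) :
    ∃ (w : Seminorm ℂ ℓ²(ι, ℂ)) (T : ℝ → ℓ²(ι, ℂ) →L[ℂ] ℓ²(ι, ℂ)),
      (∀ s t : ℝ, T (s + t) = (T s).comp (T t)) ∧
      (∀ η : ℝ, 0 < η → ∃ F : Finset ℓ²(ι, ℂ), ∀ f : ℓ²(ι, ℂ), ‖f‖ ≤ 1 →
        ∃ g ∈ F, w (f - g) < η) ∧
      (∀ ε : ℝ, 0 < ε → ∃ C : ℝ, ∀ n : ℕ, ∃ R : ℝ, ∀ f : ℓ²(ι, ℂ),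
        ‖(T 1 ^ n) f‖ ≤ C * Real.exp ((n : ℝ) * ε * 1) * ‖f‖ + R * w f) ∧
      ∀ i : ι, ∃ v : ℓ²(ι, ℂ), v ≠ 0 ∧ ∀ t : ℝ, T t v = cexp (↑t * (ρ i - 1 / 2)) • v := by
  classical
  set b : HilbertBasis ι ℂ ℓ²(ι, ℂ) := default
  -- the symbols `e^{t(ρ − 1/2)}` have modulus `e^{t (Re ρ − 1/2)} ≤ e^{|t|}`
  have hre : ∀ i, (ρ i - 1 / 2).re = (ρ i).re - 1 / 2 := fun i => by simp
  have hnorm : ∀ (t : ℝ) (i : ι),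
      ‖cexp (↑t * (ρ i - 1 / 2))‖ = Real.exp (t * ((ρ i).re - 1 / 2)) := fun t i => by
    rw [Complex.norm_exp, Complex.re_ofReal_mul, hre]
  have habs : ∀ i, |(ρ i).re - 1 / 2| ≤ 1 / 2 := fun i => by
    have := hρ i
    rw [abs_le]
    constructor <;> linarith
  have hmem : ∀ t : ℝ, Memℓp (fun i => cexp (↑t * (ρ i - 1 / 2))) ⊤ := by
    intro t
    refine memℓp_infty ⟨Real.exp |t|, ?_⟩
    rintro _ ⟨i, rfl⟩
    dsimp only
    rw [hnorm, Real.exp_le_exp]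
    calc t * ((ρ i).re - 1 / 2) ≤ |t * ((ρ i).re - 1 / 2)| := le_abs_self _
      _ = |t| * |(ρ i).re - 1 / 2| := abs_mul _ _
      _ ≤ |t| * 1 := mul_le_mul_of_nonneg_left ((habs i).trans (by norm_num)) (abs_nonneg _)
      _ = |t| := mul_one _
  set m : ℝ → lp (fun _ : ι => ℂ) ⊤ := fun t => ⟨_, hmem t⟩
  have hm : ∀ t i, m t i = cexp (↑t * (ρ i - 1 / 2)) := fun t i => rfl
  -- the weak symbol `|Re ρ − 1/2|`
  have hdmem : Memℓp (fun i => ((|(ρ i).re - 1 / 2| : ℝ) : ℂ)) ⊤ := by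
    refine memℓp_infty ⟨1 / 2, ?_⟩
    rintro _ ⟨i, rfl⟩
    dsimp only
    rw [Complex.norm_real, Real.norm_eq_abs, abs_abs]
    exact habs i
  set dℓ : lp (fun _ : ι => ℂ) ⊤ := ⟨_, hdmem⟩
  have hd : ∀ i, dℓ i = ((|(ρ i).re - 1 / 2| : ℝ) : ℂ) := fun i => rfl
  have hdnorm : ∀ i, ‖dℓ i‖ = |(ρ i).re - 1 / 2| := fun i => by
    rw [hd, Complex.norm_real, Real.norm_eq_abs, abs_abs]
  -- `D := diag(|Re ρ − 1/2|)` is compact (Halmos 171): its symbol tends to zero cofinitely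
  have hDc : IsCompactOperator (b.diagonalCLM dℓ) := by
    apply b.isCompactOperator_diagonalCLM_of_tendsto_zero
    rw [Metric.tendsto_nhds]
    intro ε hε
    simp only [dist_zero_right, norm_norm]
    simp only [hdnorm, eventually_cofinite, not_lt]
    exact hlim ε hε
  refine ⟨(normSeminorm ℂ ℓ²(ι, ℂ)).comp (b.diagonalCLM dℓ).toLinearMap,
    fun t => b.diagonalCLM (m t), hilbertBasis_diagonalCLM_symbol_add b ρ m hm, ?_, ?_, ?_⟩
  · -- finite `w`-nets of the unit ball
    intro η hη
    obtain ⟨F, hF⟩ :=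
      exists_finset_norm_map_sub_lt_of_isCompactOperator (b.diagonalCLM dℓ) hDc η hη
    exact ⟨F, hF⟩
  · -- the Lasota–Yorke inequality, `t₀ = 1`, `C = 1`
    intro ε hε
    refine ⟨1, fun n => ?_⟩
    -- `(T 1)ⁿ = T n`
    have hpow : ∀ k : ℕ, b.diagonalCLM (m 1) ^ k = b.diagonalCLM (m k) := by
      intro k
      induction k with
      | zero =>
        rw [pow_zero, Nat.cast_zero, hilbertBasis_diagonalCLM_symbol_zero b ρ m hm,
          ContinuousLinearMap.one_def]
      | succ k ih =>
        rw [pow_succ, ih, Nat.cast_succ, hilbertBasis_diagonalCLM_symbol_add b ρ m hm,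
          ContinuousLinearMap.mul_def]
    -- the small part of the symbol: `e^{n(ρ − 1/2)}` where `|Re ρ − 1/2| < ε`
    have hpbd : ∀ i, ‖(if ε ≤ |(ρ i).re - 1 / 2| then (0 : ℂ) else m n i)‖ ≤
        Real.exp (n * ε) := by
      intro i
      split_ifs with hi
      · rw [norm_zero]; positivity
      · rw [hm, hnorm, Real.exp_le_exp]
        have h1 : (ρ i).re - 1 / 2 ≤ ε := ((le_abs_self _).trans (not_le.1 hi).le)
        exact mul_le_mul_of_nonneg_left h1 (Nat.cast_nonneg n)
    have hpmem : Memℓp (fun i => if ε ≤ |(ρ i).re - 1 / 2| then (0 : ℂ) else m n i) ⊤ :=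
      memℓp_infty ⟨Real.exp (n * ε), by rintro _ ⟨i, rfl⟩; exact hpbd i⟩
    -- the part controlled by the weak seminorm: `e^{n(ρ − 1/2)} / |Re ρ − 1/2|` where
    -- `|Re ρ − 1/2| ≥ ε`
    have hqmem : Memℓp (fun i => if ε ≤ |(ρ i).re - 1 / 2| then m n i / dℓ i else (0 : ℂ)) ⊤ := by
      refine memℓp_infty ⟨Real.exp (n * (1 / 2)) / ε, ?_⟩
      rintro _ ⟨i, rfl⟩
      dsimp only
      split_ifs with hi
      · rw [norm_div, hm, hnorm, hdnorm]
        have h1 : Real.exp (↑n * ((ρ i).re - 1 / 2)) ≤ Real.exp (↑n * (1 / 2)) := by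
          rw [Real.exp_le_exp]
          have := hρ i
          exact mul_le_mul_of_nonneg_left (by linarith) (Nat.cast_nonneg n)
        calc Real.exp (↑n * ((ρ i).re - 1 / 2)) / |(ρ i).re - 1 / 2|
            ≤ Real.exp (↑n * ((ρ i).re - 1 / 2)) / ε :=
              div_le_div_of_nonneg_left (Real.exp_pos _).le hε hi
          _ ≤ Real.exp (↑n * (1 / 2)) / ε := div_le_div_of_nonneg_right h1 hε.le
      · rw [norm_zero]; positivity
    set p : lp (fun _ : ι => ℂ) ⊤ := ⟨_, hpmem⟩
    set q : lp (fun _ : ι => ℂ) ⊤ := ⟨_, hqmem⟩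
    have hp : ∀ i, p i = if ε ≤ |(ρ i).re - 1 / 2| then (0 : ℂ) else m n i := fun i => rfl
    have hq : ∀ i, q i = if ε ≤ |(ρ i).re - 1 / 2| then m n i / dℓ i else (0 : ℂ) :=
      fun i => rfl
    -- the splitting `T n = diag(p) + diag(q) ∘ D`, checked in coordinates
    have hsplit : b.diagonalCLM (m n) =
        b.diagonalCLM p + (b.diagonalCLM q).comp (b.diagonalCLM dℓ) := by
      refine ContinuousLinearMap.ext fun x => ?_
      apply b.repr.injective
      ext i
      simp only [HilbertBasis.diagonalCLM_apply_repr, add_apply, map_add, lp.coeFn_add,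
        Pi.add_apply, ContinuousLinearMap.coe_comp, Function.comp_apply, hp, hq]
      split_ifs with hi
      · have hne : dℓ i ≠ 0 := by
          rw [← norm_pos_iff, hdnorm]
          exact hε.trans_le hi
        rw [zero_mul, zero_add, ← mul_assoc, div_mul_cancel₀ _ hne]
      · rw [zero_mul, add_zero]
    have hpn : ‖p‖ ≤ Real.exp (n * ε) := lp.norm_le_of_forall_le (Real.exp_pos _).le hpbd
    refine ⟨‖b.diagonalCLM q‖, fun f => ?_⟩
    show ‖(b.diagonalCLM (m 1) ^ n) f‖ ≤
      1 * Real.exp (↑n * ε * 1) * ‖f‖ + ‖b.diagonalCLM q‖ * ‖b.diagonalCLM dℓ f‖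
    rw [one_mul, mul_one, hpow n, hsplit, add_apply, ContinuousLinearMap.coe_comp,
      Function.comp_apply]
    refine (norm_add_le _ _).trans (add_le_add ?_ ((b.diagonalCLM q).le_opNorm _))
    calc ‖b.diagonalCLM p f‖ ≤ ‖b.diagonalCLM p‖ * ‖f‖ := (b.diagonalCLM p).le_opNorm f
      _ ≤ ‖p‖ * ‖f‖ := mul_le_mul_of_nonneg_right (b.norm_diagonalCLM_le p) (norm_nonneg f)
      _ ≤ Real.exp (↑n * ε) * ‖f‖ := mul_le_mul_of_nonneg_right hpn (norm_nonneg f)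
  · -- joint eigenvectors
    intro i
    refine ⟨b i, b.orthonormal.ne_zero i, fun t => ?_⟩
    rw [b.diagonalCLM_basis, hm]

/-- **The honesty converse of the Lasota–Yorke engine (supports stmt-RiemannHypothesis-2063).**
Assuming `AsymptoticCriticalLine`, the diagonal Lasota–Yorke group on `ℓ²` over the set of
non-trivial zeros (`exists_diagonalLasotaYorkeGroup` with `ρ = Subtype.val`) realises the full
hypothesis list of `asymptoticCriticalLine_of_lasotaYorkeRealisation`: a complex Hilbert space, a
seminorm with totally bounded unit ball, a semigroup with the a-priori Lasota–Yorke inequality for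
every `ε > 0`, and one-sided joint eigenvectors `e^{t(ρ − 1/2)}` at all strip zeros `ρ`. Hence that
`∃`-typed hypothesis is equivalent to `AsymptoticCriticalLine`. [folklore] -/
theorem lasotaYorkeRealisation_of_asymptoticCriticalLine :
    Summit.RiemannHypothesis.RiemannHypothesis.Theses.RuelleBand.AsymptoticCriticalLine → ∃ (H : Type) (_ : NormedAddCommGroup H) (_ : InnerProductSpace ℂ H) (_ : CompleteSpace H) (w : Seminorm ℂ H) (T : ℝ → H →L[ℂ] H) (t₀ : ℝ), 0 < t₀ ∧ (∀ s t : ℝ, 0 ≤ s → 0 ≤ t → T (s + t) = (T s).comp (T t)) ∧ (∀ η : ℝ, 0 < η → ∃ F : Finset H, ∀ f : H, ‖f‖ ≤ 1 → ∃ g ∈ F, w (f - g) < η) ∧ (∀ ε : ℝ, 0 < ε → ∃ C : ℝ, ∀ n : ℕ, ∃ R : ℝ, ∀ f : H, ‖(T t₀ ^ n) f‖ ≤ C * Real.exp ((n : ℝ) * ε * t₀) * ‖f‖ + R * w f) ∧ (∀ s : ℂ, riemannZeta s = 0 → 0 < s.re → s.re < 1 → ∃ v : H, v ≠ 0 ∧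 ∀ t : ℝ, 0 ≤ t → T t v = Complex.exp (↑t * (s - 1 / 2)) • v) := by
  intro hA
  have hlim : ∀ ε : ℝ, 0 < ε →
      {i : {s : ℂ // riemannZeta s = 0 ∧ 0 < s.re ∧ s.re < 1} |
        ε ≤ |(i : ℂ).re - 1 / 2|}.Finite := by
    intro ε hε
    refine ((hA ε hε).preimage Set.injOn_subtype_val).subset ?_
    intro i hi
    exact ⟨i.2.1, i.2.2.1, i.2.2.2, hi⟩
  obtain ⟨w, T, hadd, hnet, hLY, heig⟩ :=
    exists_diagonalLasotaYorkeGroup (ι := {s : ℂ // riemannZeta s = 0 ∧ 0 < s.re ∧ s.re < 1})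
      (fun i => (i : ℂ)) (fun i => i.2.2) hlim
  exact ⟨ℓ²({s : ℂ // riemannZeta s = 0 ∧ 0 < s.re ∧ s.re < 1}, ℂ), inferInstance, inferInstance,
    inferInstance, w, T, 1, one_pos, fun s t _ _ => hadd s t, hnet, hLY,
    fun s hs hpos hlt => (heig ⟨s, hs, hpos, hlt⟩).imp fun v hv => ⟨hv.1, fun t _ => hv.2 t⟩⟩

end Summit.RiemannHypothesis.RiemannHypothesis.Theorems

end
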